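import Literature.Barriers.AtomisticToContinuum.DisorderedHarmonicChainPhasesProofs
import Literature.Barriers.AtomisticToContinuum.DisorderedHarmonicChainReduced
import HarnessLib

/-!
# Ajanki–Huveneers 2011, §6.1: the critical-band lower bound `𝔼 j_n(w) ≳ w²` — polar representation, the resonant set, and the reduction of (L)

Sixth file of the Casher–Lebowitz / Ajanki–Huveneers cluster (`DisorderedHarmonicChain.lean`,
`…Spectral.lean`, `…Transfer.lean`, `…Phases.lean`, `…PhasesProofs.lean`, `…Reduced.lean`); provefact
unit for the named fact (L) `AjankiHuveneers2011_criticalBandLowerBound` of `…Transfer.lean`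
(`𝔼 j_n(ω) ≥ cω²` on the band `κ/√(2n) ≤ ω ≤ κ/√n`, SIZE XL: it is §6.1 of the paper, resting on §3,
Lemma 3.7, Prop. 5.1 and Lemma 6.1). This file carries the decomposition of (L) down to its single
probabilistic core and proves everything else (O. Ajanki, F. Huveneers, CMP **301** (2011) 841–883,
arXiv:1003.1076):

* **Prop. 3.5 / Cor. 3.6 in POLAR form, PROVED everywhere** (no exceptional null set, no division): with
  the Prüfer variable `ζ_n = D_n e^{iπϑ} - D_{n-1}` (`ahZeta`) and `ρ_n = |ζ_n|` (`ahAmp`), one random step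
  is `ζ_{n+1} = e^{iπϑ}(ζ_n - π²w²B_{n+1}D_n) = e^{iπϑ} ρ_n e^{iπX_n}(1 - δ sin πX_n e^{-iπX_n})`
  (`ahZeta_succ`, `δ = π²w²b/sin πϑ`, `ahDelta`), and the factor `p + iq = (1 - δ sin α cos α) + iδ sin²α`
  has argument `arctan(q/p) = πΦ(X_n, B_{n+1})` — eq. (3.10) IS `tan πΦ = q/p` (`ahZeta_succ_polar`). Hence
  `ζ_n = ρ_n e^{iπX^x_n}` for all `n` with the LIFTED chain `X^x = ahPhase` of `…Phases.lean`
  (`ahZeta_polar`), i.e. `D_n sin πϑ = ρ_n sin πX_n` and `D_{n-1} sin πϑ = ρ_n sin π(X_n - ϑ)`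
  (`ahD_mul_sin_eq`, `ahDprev_mul_sin_eq`), `ρ_{n+1} = ρ_n√(p²+q²) ∈ [(1-|δ|)ρ_n, (1+|δ|)ρ_n]`
  (`ahAmp_succ_eq`, `ahAmp_succ_bounds`), the factors of `Γ` are the ratios `ρ_{l+1}/ρ_l`
  (`ahAmp_succ_eq_mul_ahFactor`) and `ρ_n = ρ_1 Γ^x_n` (`ahAmp_eq_mul_ahGamma`); for `e₁` (`x = ϑ`,
  `ρ_0 = 1`, `ρ_1 ≤ 5/3`) and `-e₂` (`x = 0`, `ρ_0 = ρ_1 = 1`).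
* **(6.6)–(6.7) PROVED** (`currentDensity_ge_on_resonantSet`): on the resonant set
  `E_n = {|X^ϑ_n|_𝕋 ≤ w², Γ^ϑ_n ≤ R, |X^0_n|_𝕋 ≤ cw, Γ^0_n ≤ cR}` (`|·|_𝕋` = the norm of `UnitAddCircle`) the reduced current
  density is `≥ 1/C₀(R, c, m̄)` (`resonantConst`), from `|D_n(e₁)| ≲ Rw`, `|D_{n-1}(e₁)| ≲ R`,
  `|D_n(e₂)| ≲ c²R`, `|D_{n-1}(e₂)| ≲ c(c+2)R` there (`resonant_e₁_bounds`, `resonant_e₂_bounds`;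
  `D_{n-1}` is read off `(ρ_n, X_n)`, so Cor. 3.4 (i) is not needed).
* **The probabilistic core as ONE NAMED FACT** `AjankiHuveneers2011_resonantSetProbability`
  (`P(E_n) ≥ Kw²` for `1/2 ≤ w²n ≤ 1`, `w ≤ w₀` — the last display of §6.1 fed with Prop. 5.1 and
  Lemma 6.1), together with the input of that display not yet in the tree,
  `AjankiHuveneers2011_jointBehaviourTails` (Lemma 3.7 + Lemma 6.1 in the tail form of (6.8)–(6.9)); Prop. 5.1
  and (3.21) are `AjankiHuveneers2011_potentialTheory` / `…_logGammaExpansion` of `…Phases.lean`.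
* **The reduction PROVED**: `AjankiHuveneers2011_criticalBandLowerBound_of_resonantSet :
  resonantSetProbability → criticalBandLowerBound` — reduced masses (`…Reduced.lean`), the band
  `κ = π/√𝔼M` ⟺ `1/2 ≤ w²n ≤ 1` (`band_change_of_variable`), Markov's inequality and
  `E_n ⊆ {j_n ≥ c₀}` a.e.

## Sources

* O. Ajanki, F. Huveneers, CMP 301 (2011) 841–883, arXiv:1003.1076: §2 ("Periodicity": `|x|_𝕋`), §2.2
  (the band `I = [(2n)^{-1/2}, n^{-1/2}]`, "it suffices to show that for `w ∈ I` one has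
  `P(j_n(w) ≥ Cw²) ≳ 1`" [sic; §6.1 proves `𝔼 j_n ≳ w²` via `P(E_n) ≳ w²`]), §3.1 (3.7), (3.10), (3.12)–(3.14),
  (3.17)–(3.19), Cor. 3.6 (3.22)–(3.24), §3.2 Lemma 3.7 (3.25)–(3.30), §6.1 Lemma 6.1 (6.2), (6.6)–(6.9) and the
  two closing unnumbered displays, Appendix 7.1 (A.2)–(A.4). Equation numbers are those of arXiv:1003.1076v1
  (the held copy): in §6.1, (6.2) is the bound of Lemma 6.1, (6.6) the lower bound on `j_n`, (6.7) the display
  `𝔼 j_n ≳ P(E_n)`, (6.8)–(6.9) the two `χ`-displays.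

## Design notes

* The polar form is the complex-number reading of Lemma 3.2/Prop. 3.5: `ζ_{n+1} = e^{iπϑ}(ζ_n - εD_n)` with
  `D_n = Im ζ_n / sin πϑ` is the Möbius step `𝓜_{G⁻¹AG}` of (A.2) acting on `e^{2πiX}`; working with `ζ`
  instead of the ratio `ξ_n = D_n/D_{n-1}` removes the point at infinity, the a.s. qualifier of Prop. 3.5 and
  every division, and gives `D_{n-1}` from the same `(ρ_n, X_n)`.
* `ρ_n` vs the paper's `Γ^x_n`: `Γ^x_n = ρ_n/ρ_1` exactly (`ahAmp_eq_mul_ahGamma`, including the degenerate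
  factors `= 1` of `ahFactor`); `ρ_1 = 1 + 𝒪(w²)` for `e₁` and `ρ_1 = 1` for `-e₂`, so all `≲`-statements are
  unaffected. The named facts are stated with the tree's `ahGamma`, `ahPhase`.
* Smallness is the single hypothesis `πw(1 + |B_k|) ≤ 1/2` (implies the hypothesis `(πw/2)(1+|B_k|) < 1` of
  `…Phases.lean`, `|δ| ≤ 2/3`, `sin πϑ ≥ (3/4)πw`); `smallFreq b₋ b₊` is a threshold below which it holds on
  `[b₋, b₊]^ℕ`.
* `AjankiHuveneers2011_jointBehaviourTails` quantifies `n ≥ 1` (the paper's `ℕ = {1, 2, …}`) and all real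
  `R`; `AjankiHuveneers2011_resonantSetProbability` needs no `n ≥ 1` (`w²n ≥ 1/2` forces it). Both are over
  the reduced law `ReducedLawHyp` of §2, like the facts of `…Phases.lean`; the bridge to masses is done once,
  in the final reduction.
* NOT here (next layer): the derivation `potentialTheory ∧ logGammaExpansion ∧ jointBehaviourTails →
  resonantSetProbability` (the last display of §6.1: two Markov inequalities, `Γ_n ≲ e^{w∑s(X)B}` for
  `w²n ≤ 1`, `M_n` explicit), and the discharges of Lemma 3.7 / Lemma 6.1 (Azuma) and of Prop. 5.1 (§5).
-/

noncomputable section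

open MeasureTheory Finset Real Complex

namespace Literature.Barriers.AtomisticToContinuum.HeatConduction

/-! ### Distance to the nearest integer: the norm of `UnitAddCircle = ℝ/ℤ` -/

/-- The paper's `|x|_𝕋 = min(x - ⌊x⌋, ⌈x⌉ - x)` is Mathlib's norm `‖(x : UnitAddCircle)‖ = |x - round x|` of
`ℝ/ℤ` (`UnitAddCircle.norm_eq`); `‖x‖_𝕋 ≤ |x|`. [cite: AjankiHuveneers2011, §2 "Periodicity"] -/
theorem norm_coe_unitAddCircle_le_abs (x : ℝ) : ‖(x : UnitAddCircle)‖ ≤ |x| := by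
  rw [UnitAddCircle.norm_eq]
  simpa using round_le x 0

/-- `‖x - y‖_𝕋 ≤ ‖x‖_𝕋 + |y|`. [folklore] -/
theorem norm_coe_unitAddCircle_sub_le (x y : ℝ) :
    ‖((x - y : ℝ) : UnitAddCircle)‖ ≤ ‖(x : UnitAddCircle)‖ + |y| := by
  rw [UnitAddCircle.norm_eq, UnitAddCircle.norm_eq]
  calc |x - y - round (x - y)| ≤ |x - y - round x| := round_le (x - y) (round x)
    _ = |(x - round x) + (-y)| := by ring_nf
    _ ≤ |x - round x| + |-y| := abs_add_le _ _
    _ = |x - round x| + |y| := by rw [abs_neg]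

/-- `|sin πx| ≤ π ‖x‖_𝕋`. [folklore] -/
theorem abs_sin_pi_mul_le_norm_coe (x : ℝ) : |Real.sin (π * x)| ≤ π * ‖(x : UnitAddCircle)‖ := by
  have h : Real.sin (π * x) = (-1) ^ (round x) * Real.sin (π * (x - round x)) := by
    have := Real.sin_add_int_mul_pi (π * (x - round x)) (round x)
    rw [show π * (x - ↑(round x)) + ↑(round x) * π = π * x by ring] at this
    exact this
  rw [h, abs_mul, abs_neg_one_zpow, one_mul, UnitAddCircle.norm_eq]
  calc |Real.sin (π * (x - round x))| ≤ |π * (x - round x)| := Real.abs_sin_le_abs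
    _ = π * |x - round x| := by rw [abs_mul, abs_of_pos Real.pi_pos]

/-! ### Polar (Prüfer) form of the transfer-matrix recursion -/

/-- Polar decomposition of a complex number with positive real part:
`p + iq = √(p²+q²) e^{i arctan(q/p)}`. [folklore] -/
theorem ofReal_add_mul_I_eq_polar {p : ℝ} (q : ℝ) (hp : 0 < p) :
    (p : ℂ) + (q : ℂ) * I =
      (Real.sqrt (p ^ 2 + q ^ 2) : ℂ) * Complex.exp ((Real.arctan (q / p) : ℝ) * I) := by
  have hpq : 0 < p ^ 2 + q ^ 2 := by positivity
  have hsq : Real.sqrt (1 + (q / p) ^ 2) = Real.sqrt (p ^ 2 + q ^ 2) / p := by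
    rw [show 1 + (q / p) ^ 2 = (p ^ 2 + q ^ 2) / p ^ 2 by field_simp,
      Real.sqrt_div hpq.le, Real.sqrt_sq hp.le]
  have hr : 0 < Real.sqrt (p ^ 2 + q ^ 2) := Real.sqrt_pos.mpr hpq
  have hcos : Real.sqrt (p ^ 2 + q ^ 2) * Real.cos (Real.arctan (q / p)) = p := by
    rw [Real.cos_arctan, hsq]
    field_simp
  have hsin : Real.sqrt (p ^ 2 + q ^ 2) * Real.sin (Real.arctan (q / p)) = q := by
    rw [Real.sin_arctan, hsq]
    field_simp
  set φ : ℝ := Real.arctan (q / p) with hφ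
  refine Complex.ext ?_ ?_
  · simp only [Complex.add_re, Complex.mul_re, Complex.ofReal_re, Complex.ofReal_im,
      Complex.I_re, Complex.I_im, Complex.exp_ofReal_mul_I_re, Complex.exp_ofReal_mul_I_im]
    linarith [hcos]
  · simp only [Complex.add_im, Complex.mul_im, Complex.ofReal_re, Complex.ofReal_im,
      Complex.I_re, Complex.I_im, Complex.exp_ofReal_mul_I_re, Complex.exp_ofReal_mul_I_im]
    linarith [hsin]

/-- The complex Prüfer variable `ζ_n = D_n(v) e^{iπϑ} - D_{n-1}(v)` of the recursion (2.2) driven by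
`A_k(w)` (`D_{-1} = v₋₁`). For the mean recursion `ζ_n = e^{iπϑ n} ζ_0`; in general
`ζ_{n+1} = e^{iπϑ}(ζ_n - π²w²B_{n+1} D_n)`. [cite: AjankiHuveneers2011, §3.1 eqs. (3.7), (3.12)-(3.14)] -/
def ahZeta (w : ℝ) (B : ℕ → ℝ) (v₀ v₁ : ℝ) (n : ℕ) : ℂ :=
  ((ahD (ahDiag w B) v₀ v₁ n : ℝ) : ℂ) * Complex.exp (((π * ahTheta w : ℝ) : ℂ) * I) -
    ((ahDprev (ahDiag w B) v₀ v₁ n : ℝ) : ℂ)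

/-- **The amplitude `ρ_n = |ζ_n| = |D_n e^{iπϑ} - D_{n-1}|`** (`ρ_n² = D_n² - 2cos(πϑ) D_nD_{n-1} + D_{n-1}²`),
the everywhere-defined version of the amplitude of Prop. 3.5: `Γ^x_n = ρ_n/ρ_1` (`ahAmp_eq_mul_ahGamma`).
[cite: AjankiHuveneers2011, Prop. 3.5 eq. (3.14)] -/
def ahAmp (w : ℝ) (B : ℕ → ℝ) (v₀ v₁ : ℝ) (n : ℕ) : ℝ := ‖ahZeta w B v₀ v₁ n‖

/-- The kick `δ(w, b) = π²w²b / sin πϑ = πwb/√(1 - (πw/2)²)` of one random step (twice the `δ` of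
(A.3)): in polar form the step is `ζ ↦ e^{iπϑ} ρ e^{iα}(1 - δ sin α e^{-iα})`, `α = πX`.
[cite: AjankiHuveneers2011, Appendix 7.1 eq. (A.3)] -/
def ahDelta (w b : ℝ) : ℝ := π ^ 2 * w ^ 2 * b / Real.sin (π * ahTheta w)

/-- `ρ_n ≥ 0`. [folklore] -/
theorem ahAmp_nonneg (w : ℝ) (B : ℕ → ℝ) (v₀ v₁ : ℝ) (n : ℕ) : 0 ≤ ahAmp w B v₀ v₁ n :=
  norm_nonneg _

/-- `ζ_0 = v₀ e^{iπϑ} - v₋₁`. [folklore] -/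
theorem ahZeta_zero (w : ℝ) (B : ℕ → ℝ) (v₀ v₁ : ℝ) :
    ahZeta w B v₀ v₁ 0 = (v₀ : ℂ) * Complex.exp (((π * ahTheta w : ℝ) : ℂ) * I) - (v₁ : ℂ) := by
  simp [ahZeta, ahDprev]

/-- `Im ζ_n = D_n sin πϑ`. [folklore] -/
theorem ahZeta_im (w : ℝ) (B : ℕ → ℝ) (v₀ v₁ : ℝ) (n : ℕ) :
    (ahZeta w B v₀ v₁ n).im = ahD (ahDiag w B) v₀ v₁ n * Real.sin (π * ahTheta w) := by
  unfold ahZeta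
  set θ : ℝ := π * ahTheta w with hθ
  simp only [Complex.sub_im, Complex.mul_im, Complex.ofReal_re, Complex.ofReal_im,
    Complex.exp_ofReal_mul_I_re, Complex.exp_ofReal_mul_I_im]
  ring

/-- `Im (ζ_n e^{-iπϑ}) = D_{n-1} sin πϑ`. [folklore] -/
theorem ahZeta_mul_exp_neg_im (w : ℝ) (B : ℕ → ℝ) (v₀ v₁ : ℝ) (n : ℕ) :
    (ahZeta w B v₀ v₁ n * Complex.exp (((-(π * ahTheta w) : ℝ) : ℂ) * I)).im =
      ahDprev (ahDiag w B) v₀ v₁ n * Real.sin (π * ahTheta w) := by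
  unfold ahZeta
  set θ : ℝ := π * ahTheta w with hθ
  have h1 : Complex.exp ((θ : ℂ) * I) * Complex.exp (((-θ : ℝ) : ℂ) * I) = 1 := by
    rw [← Complex.exp_add]
    push_cast
    ring_nf
    exact Complex.exp_zero
  rw [sub_mul, mul_assoc, h1, mul_one]
  simp only [Complex.sub_im, Complex.mul_im, Complex.ofReal_re, Complex.ofReal_im,
    Complex.exp_ofReal_mul_I_re, Complex.exp_ofReal_mul_I_im, Real.sin_neg]
  ring

/-- **The recursion in the Prüfer variable**: `ζ_{n+1} = e^{iπϑ}(ζ_n - π²w²B_{n+1} D_n)` (from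
`D_{n+1} = (2cos πϑ - π²w²B_{n+1})D_n - D_{n-1}` and `e^{2iπϑ} + 1 = 2cos(πϑ) e^{iπϑ}`), `|πw| ≤ 2`.
[cite: AjankiHuveneers2011, §3.1 eqs. (3.12)-(3.13)] -/
theorem ahZeta_succ {w : ℝ} (hw : π * w ≤ 2) (hw' : -2 ≤ π * w) (B : ℕ → ℝ) (v₀ v₁ : ℝ) (n : ℕ) :
    ahZeta w B v₀ v₁ (n + 1) = Complex.exp (((π * ahTheta w : ℝ) : ℂ) * I) *
      (ahZeta w B v₀ v₁ n -
        ((π ^ 2 * w ^ 2 * B n : ℝ) : ℂ) * ((ahD (ahDiag w B) v₀ v₁ n : ℝ) : ℂ)) := by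
  have hc := cos_pi_mul_ahTheta hw hw'
  have hprev : ahDprev (ahDiag w B) v₀ v₁ (n + 1) = ahD (ahDiag w B) v₀ v₁ n := rfl
  unfold ahZeta
  rw [hprev, ahD_succ_eq, ahDiag_apply]
  set θ : ℝ := π * ahTheta w with hθ
  set E := Complex.exp ((θ : ℂ) * I) with hE
  have hEE : E * E = (2 - (π : ℂ) ^ 2 * (w : ℂ) ^ 2) * E - 1 := by
    have h2 : (2 - (π : ℂ) ^ 2 * (w : ℂ) ^ 2) = (2 : ℂ) * Complex.cos (θ : ℂ) := by
      rw [← Complex.ofReal_cos, hc]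
      push_cast
      ring
    rw [h2, Complex.two_cos, ← hE]
    have hinv : Complex.exp (-(θ : ℂ) * I) * E = 1 := by
      rw [hE, ← Complex.exp_add]
      ring_nf
      exact Complex.exp_zero
    linear_combination (-1 : ℂ) * hinv
  push_cast
  linear_combination (-((ahD (ahDiag w B) v₀ v₁ n : ℝ) : ℂ)) * hEE

/-! ### Smallness of the disorder step and the kick `δ` -/

/-- The standing smallness assumption `πw(1 + |b|) ≤ 1/2` unpacked. [folklore] -/
theorem ahSmall_consequences {w b : ℝ} (hw0 : 0 < w) (h : π * w * (1 + |b|) ≤ 1 / 2) :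
    π * w ≤ 1 / 2 ∧ π * w / 2 * (1 + |b|) < 1 ∧ π * w * |b| ≤ 1 / 2 := by
  have hπw : 0 < π * w := mul_pos Real.pi_pos hw0
  have hb := abs_nonneg b
  refine ⟨by nlinarith, by nlinarith, by nlinarith⟩

/-- `3/4 ≤ √(1 - (πw/2)²) ≤ 1` for `πw ≤ 1/2`. [folklore] -/
theorem ahSqrt_bounds {w : ℝ} (hw0 : 0 ≤ w) (hw : π * w ≤ 1 / 2) :
    3 / 4 ≤ Real.sqrt (1 - (π * w / 2) ^ 2) ∧ Real.sqrt (1 - (π * w / 2) ^ 2) ≤ 1 := by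
  have hπw : 0 ≤ π * w := mul_nonneg Real.pi_pos.le hw0
  constructor
  · rw [show (3 / 4 : ℝ) = Real.sqrt ((3 / 4) ^ 2) by rw [Real.sqrt_sq]; norm_num]
    exact Real.sqrt_le_sqrt (by nlinarith)
  · calc Real.sqrt (1 - (π * w / 2) ^ 2) ≤ Real.sqrt 1 := Real.sqrt_le_sqrt (by nlinarith)
      _ = 1 := Real.sqrt_one

/-- `(3/4)πw ≤ sin πϑ ≤ πw` for `0 ≤ w`, `πw ≤ 1/2`. [cite: AjankiHuveneers2011, Lemma 3.1 eq. (3.4)] -/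
theorem sin_pi_mul_ahTheta_bounds {w : ℝ} (hw0 : 0 ≤ w) (hw : π * w ≤ 1 / 2) :
    3 / 4 * (π * w) ≤ Real.sin (π * ahTheta w) ∧ Real.sin (π * ahTheta w) ≤ π * w := by
  obtain ⟨h1, h2⟩ := ahSqrt_bounds hw0 hw
  have hπw : 0 ≤ π * w := mul_nonneg Real.pi_pos.le hw0
  rw [sin_pi_mul_ahTheta hw0]
  constructor
  · nlinarith [mul_le_mul_of_nonneg_left h1 hπw]
  · nlinarith [mul_le_mul_of_nonneg_left h2 hπw]

/-- `δ(w,b) = πwb/√(1 - (πw/2)²)`. [cite: AjankiHuveneers2011, Appendix 7.1 eq. (A.3)] -/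
theorem ahDelta_eq {w : ℝ} (hw0 : 0 < w) (hw : π * w ≤ 1 / 2) (b : ℝ) :
    ahDelta w b = π * w * b / Real.sqrt (1 - (π * w / 2) ^ 2) := by
  obtain ⟨h1, -⟩ := ahSqrt_bounds hw0.le hw
  have hs : Real.sqrt (1 - (π * w / 2) ^ 2) ≠ 0 := by positivity
  have hπw : π * w ≠ 0 := (mul_pos Real.pi_pos hw0).ne'
  rw [ahDelta, sin_pi_mul_ahTheta hw0.le]
  field_simp

/-- `|δ(w,b)| ≤ (4/3)πw|b| ≤ 2/3` under the smallness assumption. [folklore] -/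
theorem abs_ahDelta_le {w b : ℝ} (hw0 : 0 < w) (h : π * w * (1 + |b|) ≤ 1 / 2) :
    |ahDelta w b| ≤ 4 / 3 * (π * w * |b|) ∧ |ahDelta w b| ≤ 2 / 3 := by
  obtain ⟨hw, -, hwb⟩ := ahSmall_consequences hw0 h
  obtain ⟨h1, -⟩ := ahSqrt_bounds hw0.le hw
  have hs : 0 < Real.sqrt (1 - (π * w / 2) ^ 2) := by positivity
  have hπw : 0 ≤ π * w := (mul_pos Real.pi_pos hw0).le
  have key : |ahDelta w b| ≤ 4 / 3 * (π * w * |b|) := by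
    rw [ahDelta_eq hw0 hw, abs_div, abs_of_pos hs, div_le_iff₀ hs, abs_mul, abs_of_nonneg hπw]
    nlinarith [mul_nonneg hπw (abs_nonneg b)]
  exact ⟨key, by nlinarith⟩

/-! ### The polar step -/

/-- `‖r e^{it}‖ = r` for `r ≥ 0`. [folklore] -/
theorem norm_ofReal_mul_exp_mul_I {r : ℝ} (hr : 0 ≤ r) (t : ℝ) :
    ‖(r : ℂ) * Complex.exp ((t : ℂ) * I)‖ = r := by
  rw [norm_mul, Complex.norm_real, Real.norm_eq_abs, abs_of_nonneg hr,
    Complex.norm_exp_ofReal_mul_I, mul_one]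

/-- `πΦ(x,b) = arctan(N/D)`. [cite: AjankiHuveneers2011, Lemma 3.2 eq. (3.10)] -/
theorem pi_mul_ahPhi (w x b : ℝ) : π * ahPhi w x b = Real.arctan (ahNum w x b / ahDen w x b) := by
  unfold ahPhi
  field_simp

/-- **One random step in polar form**: if `ζ_n = ρ_n e^{iπX_n}` then
`ζ_{n+1} = ρ_n √(p² + q²) · e^{iπX_{n+1}}` with `p = 1 - δ sin πX_n cos πX_n`, `q = δ sin² πX_n`,
`δ = δ(w, B_{n+1})`, `X_{n+1} = f_{B_{n+1}}(X_n)` — i.e. `e^{iπϑ}ρe^{iα}(1 - δ sin α e^{-iα})` has modulus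
`ρ√(p²+q²)` and argument `α + πϑ + arctan(q/p) = α + πϑ + πΦ(X_n, B_{n+1})`, (3.10) being exactly
`tan πΦ = q/p`. [cite: AjankiHuveneers2011, Lemma 3.2 eqs. (3.8)-(3.10) and Appendix 7.1 (A.2)-(A.4)] -/
theorem ahZeta_succ_polar {w x : ℝ} {B : ℕ → ℝ} {v₀ v₁ : ℝ} (hw0 : 0 < w) {n : ℕ}
    (hB : π * w * (1 + |B n|) ≤ 1 / 2)
    (hζ : ahZeta w B v₀ v₁ n =
      (ahAmp w B v₀ v₁ n : ℂ) * Complex.exp (((π * ahPhase w x B n : ℝ) : ℂ) * I)) :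
    ahZeta w B v₀ v₁ (n + 1) =
      ((ahAmp w B v₀ v₁ n *
          Real.sqrt ((1 - ahDelta w (B n) * Real.sin (π * ahPhase w x B n) *
              Real.cos (π * ahPhase w x B n)) ^ 2 +
            (ahDelta w (B n) * Real.sin (π * ahPhase w x B n) ^ 2) ^ 2) : ℝ) : ℂ) *
        Complex.exp (((π * ahPhase w x B (n + 1) : ℝ) : ℂ) * I) := by
  obtain ⟨hw, hwb1, hwb⟩ := ahSmall_consequences hw0 hB
  obtain ⟨hs1, hs2⟩ := ahSqrt_bounds hw0.le hw
  have hπw : 0 < π * w := mul_pos Real.pi_pos hw0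
  have hw2 : π * w ≤ 2 := by linarith
  have hw2' : -2 ≤ π * w := by linarith
  have hsin := sin_pi_mul_ahTheta hw0.le
  have hsin_pos : 0 < Real.sin (π * ahTheta w) := by
    rw [hsin]; positivity
  have hstep := ahZeta_succ hw2 hw2' B v₀ v₁ n
  -- notation
  set θ : ℝ := π * ahTheta w with hθ
  set X : ℝ := ahPhase w x B n with hX
  set α : ℝ := π * X with hα
  set ρ : ℝ := ahAmp w B v₀ v₁ n with hρ
  set b : ℝ := B n with hb
  set δ : ℝ := ahDelta w b with hδ
  set s₀ : ℝ := Real.sqrt (1 - (π * w / 2) ^ 2) with hs₀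
  have hs₀_pos : 0 < s₀ := by positivity
  set p : ℝ := 1 - δ * Real.sin α * Real.cos α with hp
  set q : ℝ := δ * Real.sin α ^ 2 with hq
  -- `D_n = ρ sin α / sin θ`
  have hD : ahD (ahDiag w B) v₀ v₁ n * Real.sin θ = ρ * Real.sin α := by
    have h := congrArg Complex.im hζ
    rw [ahZeta_im] at h
    rw [h]
    simp only [Complex.mul_im, Complex.ofReal_re, Complex.ofReal_im, Complex.exp_ofReal_mul_I_re,
      Complex.exp_ofReal_mul_I_im]
    ring
  -- `p, q` in terms of the numerator and denominator of (3.10)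
  have hδ' : δ = π * w * b / s₀ := by rw [hδ, ahDelta_eq hw0 hw]
  have hp' : p = ahDen w X b / s₀ := by
    rw [hp, ahDen_eq, hδ', ← hs₀, ← hα]
    field_simp
  have hq' : q = ahNum w X b / s₀ := by
    rw [hq, ahNum_eq, hδ', ← hα]
    field_simp
  have hDen_pos : 0 < ahDen w X b := ahDen_pos (x := X) hw0.le hwb1
  have hp_pos : 0 < p := by rw [hp']; positivity
  have hqp : q / p = ahNum w X b / ahDen w X b := by
    rw [hp', hq']
    field_simp
  -- the argument of the step
  have harg : Real.arctan (q / p) = π * ahPhi w X b := by rw [hqp, pi_mul_ahPhi]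
  have hnext : π * ahPhase w x B (n + 1) = θ + α + Real.arctan (q / p) := by
    rw [ahPhase_succ, ← hX, ← hb, harg, hα, hθ]
    unfold ahStep
    ring
  -- the computation
  have hpolar := ofReal_add_mul_I_eq_polar q hp_pos
  have hDc : ((ahD (ahDiag w B) v₀ v₁ n : ℝ) : ℂ) = ((ρ * Real.sin α / Real.sin θ : ℝ) : ℂ) := by
    congr 1
    rw [eq_div_iff hsin_pos.ne', hD]
  have hε : ((π ^ 2 * w ^ 2 * B n : ℝ) : ℂ) * ((ρ * Real.sin α / Real.sin θ : ℝ) : ℂ) =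
      ((ρ * (δ * Real.sin α) : ℝ) : ℂ) := by
    rw [← Complex.ofReal_mul]
    congr 1
    rw [hδ, ahDelta, ← hθ, ← hb]
    field_simp
  rw [hstep, hζ, hDc, hε, hnext]
  -- reduce to an identity between complex exponentials
  have hexp3 : Complex.exp (((θ + α + Real.arctan (q / p) : ℝ) : ℂ) * I) =
      Complex.exp ((θ : ℂ) * I) * Complex.exp ((α : ℂ) * I) *
        Complex.exp (((Real.arctan (q / p) : ℝ) : ℂ) * I) := by
    rw [← Complex.exp_add, ← Complex.exp_add]
    push_cast
    ring_nf
  have hkey : (ρ : ℂ) * Complex.exp ((α : ℂ) * I) - ((ρ * (δ * Real.sin α) : ℝ) : ℂ) =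
      (ρ : ℂ) * Complex.exp ((α : ℂ) * I) * ((p : ℂ) + (q : ℂ) * I) := by
    rw [hp, hq]
    push_cast
    rw [Complex.exp_mul_I]
    have hpy : (Complex.cos (α : ℂ)) ^ 2 + (Complex.sin (α : ℂ)) ^ 2 = 1 := by
      rw [add_comm]; exact Complex.sin_sq_add_cos_sq (α : ℂ)
    linear_combination ((ρ : ℂ) * (δ : ℂ) * Complex.sin (α : ℂ)) * hpy -
      ((ρ : ℂ) * (δ : ℂ) * Complex.sin (α : ℂ) ^ 3) * Complex.I_sq
  rw [hexp3, show (((π * X : ℝ) : ℂ)) = (α : ℂ) by rw [hα], hkey, hpolar]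
  push_cast
  ring

/-- **Prop. 3.5 in polar form, exact and everywhere**: if `ζ_0 = |ζ_0| e^{iπx}` then for all `n`,
`ζ_n = ρ_n e^{iπX^x_n}`, i.e. `D_n e^{iπϑ} - D_{n-1} = ρ_n e^{iπ X^x_n}` with the LIFTED phase chain
`X^x` of Def. 3.3 and `ρ_n = |ζ_n|` — the representation (3.14)/(3.18) with no exceptional null set
and no division (`0 < w`, `πw(1 + |B_k|) ≤ 1/2`). [cite: AjankiHuveneers2011, Prop. 3.5 eqs. (3.14), (3.18)] -/
theorem ahZeta_polar {w x : ℝ} {B : ℕ → ℝ} {v₀ v₁ : ℝ} (hw0 : 0 < w)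
    (hB : ∀ k, π * w * (1 + |B k|) ≤ 1 / 2)
    (h0 : ahZeta w B v₀ v₁ 0 = (ahAmp w B v₀ v₁ 0 : ℂ) * Complex.exp (((π * x : ℝ) : ℂ) * I)) :
    ∀ n, ahZeta w B v₀ v₁ n =
      (ahAmp w B v₀ v₁ n : ℂ) * Complex.exp (((π * ahPhase w x B n : ℝ) : ℂ) * I)
  | 0 => by rw [ahPhase_zero]; exact h0
  | n + 1 => by
    have h := ahZeta_succ_polar hw0 (hB n) (ahZeta_polar hw0 hB h0 n)
    rw [h]
    congr 2
    change _ = ‖ahZeta w B v₀ v₁ (n + 1)‖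
    rw [h, norm_ofReal_mul_exp_mul_I (mul_nonneg (ahAmp_nonneg _ _ _ _ _) (Real.sqrt_nonneg _))]

/-- `(1 - |δ|)² ≤ p² + q² ≤ (1 + |δ|)²` for `|δ| ≤ 1` (`p² + q² = 1 - δ sin 2α + δ² sin²α`). [folklore] -/
theorem ahStepModulus_bounds {δ : ℝ} (hδ : |δ| ≤ 1) (α : ℝ) :
    (1 - |δ|) ^ 2 ≤ (1 - δ * Real.sin α * Real.cos α) ^ 2 + (δ * Real.sin α ^ 2) ^ 2 ∧
      (1 - δ * Real.sin α * Real.cos α) ^ 2 + (δ * Real.sin α ^ 2) ^ 2 ≤ (1 + |δ|) ^ 2 := by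
  have hpy := Real.sin_sq_add_cos_sq α
  have hid : (1 - δ * Real.sin α * Real.cos α) ^ 2 + (δ * Real.sin α ^ 2) ^ 2 =
      1 - δ * (2 * Real.sin α * Real.cos α) + δ ^ 2 * Real.sin α ^ 2 := by
    linear_combination (δ ^ 2 * Real.sin α ^ 2) * hpy
  rw [hid]
  have hu : |δ * (2 * Real.sin α * Real.cos α)| ≤ |δ| := by
    rw [abs_mul, ← Real.sin_two_mul]
    exact mul_le_of_le_one_right (abs_nonneg δ) (Real.abs_sin_le_one _)
  have hu' := abs_le.mp hu
  have hv0 : 0 ≤ δ ^ 2 * Real.sin α ^ 2 := by positivity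
  have hv1 : δ ^ 2 * Real.sin α ^ 2 ≤ δ ^ 2 := by
    calc δ ^ 2 * Real.sin α ^ 2 ≤ δ ^ 2 * 1 := mul_le_mul_of_nonneg_left (Real.sin_sq_le_one α) (sq_nonneg δ)
      _ = δ ^ 2 := mul_one _
  have hδ2 : δ ^ 2 = |δ| ^ 2 := (sq_abs δ).symm
  have hδ0 := abs_nonneg δ
  constructor <;> nlinarith

section PolarConsequences

variable {w x : ℝ} {B : ℕ → ℝ} {v₀ v₁ : ℝ} (hw0 : 0 < w) (hB : ∀ k, π * w * (1 + |B k|) ≤ 1 / 2)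
  (h0 : ahZeta w B v₀ v₁ 0 = (ahAmp w B v₀ v₁ 0 : ℂ) * Complex.exp (((π * x : ℝ) : ℂ) * I))
include hw0 hB h0

/-- **`D_n sin πϑ = ρ_n sin πX_n`** (imaginary part of the polar form): the numerator of (3.14)/(3.18).
[cite: AjankiHuveneers2011, Prop. 3.5 eq. (3.18)] -/
theorem ahD_mul_sin_eq (n : ℕ) :
    ahD (ahDiag w B) v₀ v₁ n * Real.sin (π * ahTheta w) =
      ahAmp w B v₀ v₁ n * Real.sin (π * ahPhase w x B n) := by
  have h := congrArg Complex.im (ahZeta_polar hw0 hB h0 n)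
  rw [ahZeta_im] at h
  rw [h]
  simp only [Complex.mul_im, Complex.ofReal_re, Complex.ofReal_im, Complex.exp_ofReal_mul_I_re,
    Complex.exp_ofReal_mul_I_im]
  ring

/-- **`D_{n-1} sin πϑ = ρ_n sin π(X_n - ϑ)`**: the previous matrix element from the SAME `(ρ_n, X_n)`
(`D_n/D_{n-1} = g(X_n) = sin πX_n / sin π(X_n - ϑ)`, eq. (3.17)). [cite: AjankiHuveneers2011, Prop. 3.5 eq. (3.17)] -/
theorem ahDprev_mul_sin_eq (n : ℕ) :
    ahDprev (ahDiag w B) v₀ v₁ n * Real.sin (π * ahTheta w) =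
      ahAmp w B v₀ v₁ n * Real.sin (π * (ahPhase w x B n - ahTheta w)) := by
  have h := congrArg (fun z => (z * Complex.exp (((-(π * ahTheta w) : ℝ) : ℂ) * I)).im)
    (ahZeta_polar hw0 hB h0 n)
  rw [ahZeta_mul_exp_neg_im] at h
  rw [h, mul_assoc, ← Complex.exp_add, ← add_mul, ← Complex.ofReal_add,
    show π * ahPhase w x B n + -(π * ahTheta w) = π * (ahPhase w x B n - ahTheta w) by ring]
  simp only [Complex.mul_im, Complex.ofReal_re, Complex.ofReal_im, Complex.exp_ofReal_mul_I_re,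
    Complex.exp_ofReal_mul_I_im]
  ring

/-- The amplitude recursion `ρ_{n+1} = ρ_n √(p² + q²)`, `p = 1 - δ sin πX_n cos πX_n`, `q = δ sin²πX_n`
(modulus of the factor `1 - δ sin α e^{-iα}`; its logarithm is (3.19)).
[cite: AjankiHuveneers2011, Prop. 3.5 eq. (3.19)] -/
theorem ahAmp_succ_eq (n : ℕ) :
    ahAmp w B v₀ v₁ (n + 1) = ahAmp w B v₀ v₁ n *
      Real.sqrt ((1 - ahDelta w (B n) * Real.sin (π * ahPhase w x B n) *
          Real.cos (π * ahPhase w x B n)) ^ 2 +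
        (ahDelta w (B n) * Real.sin (π * ahPhase w x B n) ^ 2) ^ 2) := by
  have h := ahZeta_succ_polar hw0 (hB n) (ahZeta_polar hw0 hB h0 n)
  change ‖ahZeta w B v₀ v₁ (n + 1)‖ = _
  rw [h, norm_ofReal_mul_exp_mul_I (mul_nonneg (ahAmp_nonneg _ _ _ _ _) (Real.sqrt_nonneg _))]

/-- **One-step amplitude ratio**: `(1 - |δ_{n+1}|)ρ_n ≤ ρ_{n+1} ≤ (1 + |δ_{n+1}|)ρ_n` — every step changes
the amplitude by a factor `1 + 𝒪(w)` ("`Γ_{n-1} ∈ [0, 2R]` when `Γ_n ∈ [0, R]`", §6.1).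
[cite: AjankiHuveneers2011, Prop. 3.5 eq. (3.19) and §6.1] -/
theorem ahAmp_succ_bounds (n : ℕ) :
    (1 - |ahDelta w (B n)|) * ahAmp w B v₀ v₁ n ≤ ahAmp w B v₀ v₁ (n + 1) ∧
      ahAmp w B v₀ v₁ (n + 1) ≤ (1 + |ahDelta w (B n)|) * ahAmp w B v₀ v₁ n := by
  obtain ⟨-, hδ⟩ := abs_ahDelta_le hw0 (hB n)
  have hδ1 : |ahDelta w (B n)| ≤ 1 := by linarith
  obtain ⟨h1, h2⟩ := ahStepModulus_bounds hδ1 (π * ahPhase w x B n)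
  have hρ := ahAmp_nonneg w B v₀ v₁ n
  rw [ahAmp_succ_eq hw0 hB h0 n]
  constructor
  · rw [mul_comm]
    refine mul_le_mul_of_nonneg_left ?_ hρ
    calc 1 - |ahDelta w (B n)| = Real.sqrt ((1 - |ahDelta w (B n)|) ^ 2) :=
          (Real.sqrt_sq (by linarith)).symm
      _ ≤ _ := Real.sqrt_le_sqrt h1
  · rw [mul_comm (1 + |ahDelta w (B n)|)]
    refine mul_le_mul_of_nonneg_left ?_ hρ
    calc _ ≤ Real.sqrt ((1 + |ahDelta w (B n)|) ^ 2) := Real.sqrt_le_sqrt h2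
      _ = 1 + |ahDelta w (B n)| := Real.sqrt_sq (by positivity)

/-- The amplitude never vanishes (given `ρ_0 > 0`). [folklore] -/
theorem ahAmp_pos (hρ : 0 < ahAmp w B v₀ v₁ 0) : ∀ n, 0 < ahAmp w B v₀ v₁ n
  | 0 => hρ
  | n + 1 => by
    obtain ⟨-, hδ⟩ := abs_ahDelta_le hw0 (hB n)
    have h := (ahAmp_succ_bounds hw0 hB h0 n).1
    have hp := ahAmp_pos hρ n
    nlinarith

/-- **The factors of `Γ` are the amplitude ratios**: `ρ_{l+1} = ρ_l · [sin πX_l / sin π(X_l + Φ(X_l,B_{l+1}))]`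
(with the factor `= 1` where `sin πX_l = 0`), i.e. `ahFactor` of `…Phases.lean` is exactly `ρ_{l+1}/ρ_l`.
[cite: AjankiHuveneers2011, Prop. 3.5 eqs. (3.14), (3.17)] -/
theorem ahAmp_succ_eq_mul_ahFactor (hρ : 0 < ahAmp w B v₀ v₁ 0) (l : ℕ) :
    ahAmp w B v₀ v₁ (l + 1) = ahAmp w B v₀ v₁ l * ahFactor w (ahPhase w x B l) (B l) := by
  unfold ahFactor
  split_ifs with hs
  · rw [ahAmp_succ_eq hw0 hB h0 l, hs]
    simp
  · have h1 := ahD_mul_sin_eq hw0 hB h0 l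
    have h2 := ahDprev_mul_sin_eq hw0 hB h0 (l + 1)
    have hprev : ahDprev (ahDiag w B) v₀ v₁ (l + 1) = ahD (ahDiag w B) v₀ v₁ l := rfl
    have hX : ahPhase w x B (l + 1) - ahTheta w = ahPhase w x B l + ahPhi w (ahPhase w x B l) (B l) := by
      rw [ahPhase_succ]; unfold ahStep; ring
    rw [hprev, h1, hX] at h2
    -- `h2 : ρ_l sin πX_l = ρ_{l+1} sin π(X_l + Φ_l)`
    have hρl := ahAmp_pos hw0 hB h0 hρ l
    have hne : Real.sin (π * (ahPhase w x B l + ahPhi w (ahPhase w x B l) (B l))) ≠ 0 := by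
      intro hz
      rw [hz, mul_zero] at h2
      rcases mul_eq_zero.mp h2 with h | h
      · exact hρl.ne' h
      · exact hs h
    rw [mul_div_assoc', eq_div_iff hne]
    exact h2.symm

/-- **`ρ_n = ρ_1 Γ^x_n`** (`n ≥ 1`): the amplitude `Γ^x_n = ∏_{l=1}^{n-1}(ρ_{l+1}/ρ_l)` of (3.14) is the
polar amplitude normalised at `n = 1`. [cite: AjankiHuveneers2011, Prop. 3.5 eq. (3.14)] -/
theorem ahAmp_eq_mul_ahGamma (hρ : 0 < ahAmp w B v₀ v₁ 0) {n : ℕ} (hn : 1 ≤ n) :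
    ahAmp w B v₀ v₁ n = ahAmp w B v₀ v₁ 1 * ahGamma w x B n := by
  induction n, hn using Nat.le_induction with
  | base => simp [ahGamma]
  | succ n hn ih =>
    rw [ahAmp_succ_eq_mul_ahFactor hw0 hB h0 hρ n, ih, ahGamma, ahGamma,
      Finset.prod_Ico_succ_top hn, mul_assoc]

end PolarConsequences

/-! ### The two chains of Cor. 3.6: `D_n(e₁)` from `x = ϑ`, `D_n(e₂)` from `x = 0` -/

/-- For `v = e₁`: `ζ_0 = e^{iπϑ}`, `ρ_0 = 1`, start `x = ϑ`. [cite: AjankiHuveneers2011, Cor. 3.6 eq. (3.22)] -/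
theorem ahZeta_e₁_zero (w : ℝ) (B : ℕ → ℝ) :
    ahAmp w B 1 0 0 = 1 ∧
      ahZeta w B 1 0 0 = (ahAmp w B 1 0 0 : ℂ) * Complex.exp (((π * ahTheta w : ℝ) : ℂ) * I) := by
  have hz : ahZeta w B 1 0 0 = Complex.exp (((π * ahTheta w : ℝ) : ℂ) * I) := by
    rw [ahZeta_zero]; simp
  have ha : ahAmp w B 1 0 0 = 1 := by
    rw [ahAmp, hz, Complex.norm_exp_ofReal_mul_I]
  refine ⟨ha, ?_⟩
  rw [ha, hz]
  simp

/-- For `v = -e₂` (`D_n(-e₂) = -D_n(e₂)`): `ζ_0 = 1`, `ρ_0 = 1`, start `x = 0` — the chain `X^0` of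
Cor. 3.6. [cite: AjankiHuveneers2011, Cor. 3.6 eqs. (3.23)-(3.24)] -/
theorem ahZeta_negE₂_zero (w : ℝ) (B : ℕ → ℝ) :
    ahAmp w B 0 (-1) 0 = 1 ∧
      ahZeta w B 0 (-1) 0 = (ahAmp w B 0 (-1) 0 : ℂ) * Complex.exp (((π * 0 : ℝ) : ℂ) * I) := by
  have hz : ahZeta w B 0 (-1) 0 = 1 := by
    rw [ahZeta_zero]; simp
  have ha : ahAmp w B 0 (-1) 0 = 1 := by
    rw [ahAmp, hz, norm_one]
  refine ⟨ha, ?_⟩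
  rw [ha, hz]
  simp

/-- For `v = -e₂` also `ρ_1 = 1` (`ζ_1 = D_1 e^{iπϑ} - D_0 = e^{iπϑ}`), so `Γ^0_n = ρ_n` exactly. [folklore] -/
theorem ahAmp_negE₂_one (w : ℝ) (B : ℕ → ℝ) : ahAmp w B 0 (-1) 1 = 1 := by
  have hz : ahZeta w B 0 (-1) 1 = Complex.exp (((π * ahTheta w : ℝ) : ℂ) * I) := by
    simp [ahZeta, ahDprev]
  rw [ahAmp, hz, Complex.norm_exp_ofReal_mul_I]

/-- For `v = e₁`, `ρ_1 ≤ 1 + |δ(w, B_1)| ≤ 5/3`. [folklore] -/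
theorem ahAmp_e₁_one_le {w : ℝ} {B : ℕ → ℝ} (hw0 : 0 < w) (hB : ∀ k, π * w * (1 + |B k|) ≤ 1 / 2) :
    ahAmp w B 1 0 1 ≤ 5 / 3 := by
  obtain ⟨ha, h0⟩ := ahZeta_e₁_zero w B
  have h := (ahAmp_succ_bounds hw0 hB h0 0).2
  obtain ⟨-, hδ⟩ := abs_ahDelta_le hw0 (hB 0)
  rw [ha, mul_one] at h
  linarith

/-- `D_n(-e₂) = -D_n(e₂)`. [cite: AjankiHuveneers2011, proof of Cor. 3.6 ("`D_n(-v) = -D_n(v)`")] -/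
theorem ahD_negE₂ (d : ℕ → ℝ) (n : ℕ) : ahD d 0 (-1) n = -ahD d 0 1 n := by
  rw [ahD_eq_lin d 0 (-1) n]; ring

/-- `D_{n-1}(-e₂) = -D_{n-1}(e₂)` (`n ≥ 1`). [folklore] -/
theorem ahDprev_negE₂_succ (d : ℕ → ℝ) (k : ℕ) : ahDprev d 0 (-1) (k + 1) = -ahD d 0 1 k :=
  ahD_negE₂ d k

/-! ### (6.6)–(6.7): on the resonant set the current density is of order one -/

/-- From `D S = ρ s`, `|s| ≤ t`, `0 ≤ ρ ≤ L`, `S ≥ (3/4)πw > 0`: `D² ≤ (16/9)(Lt)²/(πw)²`. [folklore] -/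
theorem sq_le_of_mul_sin_eq {D S ρ s L t w : ℝ} (hw : 0 < w) (hS : 3 / 4 * (π * w) ≤ S)
    (h : D * S = ρ * s) (hs : |s| ≤ t) (hρ0 : 0 ≤ ρ) (hρ : ρ ≤ L) :
    D ^ 2 ≤ 16 / 9 * (L * t) ^ 2 / (π * w) ^ 2 := by
  have hπw : 0 < π * w := mul_pos Real.pi_pos hw
  have hS0 : 0 < S := lt_of_lt_of_le (by positivity) hS
  have h1 : |D| * S ≤ L * t := by
    rw [← abs_of_pos hS0, ← abs_mul, h, abs_mul, abs_of_nonneg hρ0]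
    exact mul_le_mul hρ hs (abs_nonneg _) (hρ0.trans hρ)
  have h2 : |D| ≤ L * t / S := by rwa [le_div_iff₀ hS0]
  calc D ^ 2 = |D| ^ 2 := (sq_abs D).symm
    _ ≤ (L * t / S) ^ 2 := pow_le_pow_left₀ (abs_nonneg D) h2 2
    _ = (L * t) ^ 2 / S ^ 2 := by rw [div_pow]
    _ ≤ (L * t) ^ 2 / (3 / 4 * (π * w)) ^ 2 :=
        div_le_div_of_nonneg_left (sq_nonneg _) (by positivity) (pow_le_pow_left₀ (by positivity) hS 2)
    _ = 16 / 9 * (L * t) ^ 2 / (π * w) ^ 2 := by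
        field_simp
        ring

/-- `w² ≤ w` and `w³ ≤ w` on `(0, 1]`. [folklore] -/
theorem pow_le_self_aux {w : ℝ} (hw0 : 0 < w) (hw1 : w ≤ 1) : w ^ 2 ≤ w ∧ w ^ 3 ≤ w := by
  have h2 : w ^ 2 ≤ w := by
    calc w ^ 2 = w * w := sq w
      _ ≤ w * 1 := mul_le_mul_of_nonneg_left hw1 hw0.le
      _ = w := mul_one w
  refine ⟨h2, ?_⟩
  calc w ^ 3 = w * w ^ 2 := by ring
    _ ≤ w * 1 := mul_le_mul_of_nonneg_left (h2.trans hw1) hw0.le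
    _ = w := mul_one w

/-- **The `e₁`-chain on the resonant set**: `|X^ϑ_n|_𝕋 ≤ w²` and `Γ^ϑ_n ≤ R` give
`D_n(e₁)² ≤ (64/9)R²w²` and `D_{n-1}(e₁)² ≤ 64R²` (`n = k+1`; `ρ_n = ρ_1Γ^ϑ_n ≤ (5/3)R`,
`|sin πX_n| ≤ πw²`, `|sin π(X_n - ϑ)| ≤ π(w² + ϑ) ≤ 3πw`, `sin πϑ ≥ (3/4)πw`).
[cite: AjankiHuveneers2011, §6.1 eqs. (6.6)-(6.7)] -/
theorem resonant_e₁_bounds {w : ℝ} {B : ℕ → ℝ} (hw0 : 0 < w) (hw1 : w ≤ 1)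
    (hB : ∀ k, π * w * (1 + |B k|) ≤ 1 / 2) {R : ℝ} (hR : 0 ≤ R) (k : ℕ)
    (h1 : ‖(ahPhase w (ahTheta w) B (k + 1) : UnitAddCircle)‖ ≤ w ^ 2) (h2 : ahGamma w (ahTheta w) B (k + 1) ≤ R) :
    ahD (ahDiag w B) 1 0 (k + 1) ^ 2 ≤ 64 / 9 * R ^ 2 * w ^ 2 ∧
      ahD (ahDiag w B) 1 0 k ^ 2 ≤ 64 * R ^ 2 := by
  have hπ := Real.pi_pos
  obtain ⟨hw_half, -, -⟩ := ahSmall_consequences hw0 (hB 0)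
  have hπw : 0 < π * w := mul_pos hπ hw0
  have hw5 : w ≤ 1 / 5 := by
    have h3w : 3 * w ≤ π * w := mul_le_mul_of_nonneg_right Real.pi_gt_three.le hw0.le
    linarith
  obtain ⟨hS, -⟩ := sin_pi_mul_ahTheta_bounds hw0.le hw_half
  have hθ0 : 0 ≤ ahTheta w := (ahTheta_pos hw0).le
  have hθ1 : ahTheta w ≤ w + w ^ 3 := ahTheta_le hw0.le hw5
  obtain ⟨hw21, hw32⟩ := pow_le_self_aux hw0 hw1
  obtain ⟨ha1, h01⟩ := ahZeta_e₁_zero w B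
  have hρpos : 0 < ahAmp w B 1 0 0 := by rw [ha1]; exact one_pos
  have hρ_nonneg : 0 ≤ ahAmp w B 1 0 (k + 1) := ahAmp_nonneg _ _ _ _ _
  have hρ_le : ahAmp w B 1 0 (k + 1) ≤ 2 * R := by
    rw [ahAmp_eq_mul_ahGamma hw0 hB h01 hρpos (Nat.succ_pos k)]
    have ha := ahAmp_e₁_one_le hw0 hB
    calc ahAmp w B 1 0 1 * ahGamma w (ahTheta w) B (k + 1) ≤ ahAmp w B 1 0 1 * R :=
          mul_le_mul_of_nonneg_left h2 (ahAmp_nonneg _ _ _ _ _)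
      _ ≤ 5 / 3 * R := mul_le_mul_of_nonneg_right ha hR
      _ ≤ 2 * R := by linarith
  have hD := ahD_mul_sin_eq hw0 hB h01 (k + 1)
  have hP := ahDprev_mul_sin_eq hw0 hB h01 (k + 1)
  rw [show ahDprev (ahDiag w B) 1 0 (k + 1) = ahD (ahDiag w B) 1 0 k from rfl] at hP
  have hs1 : |Real.sin (π * ahPhase w (ahTheta w) B (k + 1))| ≤ π * w ^ 2 :=
    (abs_sin_pi_mul_le_norm_coe _).trans (mul_le_mul_of_nonneg_left h1 hπ.le)
  have hs2 : |Real.sin (π * (ahPhase w (ahTheta w) B (k + 1) - ahTheta w))| ≤ π * (3 * w) := by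
    refine (abs_sin_pi_mul_le_norm_coe _).trans (mul_le_mul_of_nonneg_left ?_ hπ.le)
    refine (norm_coe_unitAddCircle_sub_le _ (ahTheta w)).trans ?_
    rw [abs_of_nonneg hθ0]
    linarith
  have hπw0 : (π * w) ^ 2 ≠ 0 := by positivity
  constructor
  · have h := sq_le_of_mul_sin_eq hw0 hS hD hs1 hρ_nonneg hρ_le
    have : 16 / 9 * (2 * R * (π * w ^ 2)) ^ 2 / (π * w) ^ 2 = 64 / 9 * R ^ 2 * w ^ 2 := by
      rw [div_eq_iff hπw0]
      ring
    linarith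
  · have h := sq_le_of_mul_sin_eq hw0 hS hP hs2 hρ_nonneg hρ_le
    have : 16 / 9 * (2 * R * (π * (3 * w))) ^ 2 / (π * w) ^ 2 = 64 * R ^ 2 := by
      rw [div_eq_iff hπw0]
      ring
    linarith

/-- **The `e₂`-chain on the resonant set**: `|X^0_n|_𝕋 ≤ cw` and `Γ^0_n ≤ cR` give
`D_n(e₂)² ≤ (16/9)c⁴R²` and `D_{n-1}(e₂)² ≤ (16/9)c²(c+2)²R²` (`n = k+1`; `ρ_n = Γ^0_n` for `v = -e₂`,
`|sin πX_n| ≤ πcw`, `|sin π(X_n - ϑ)| ≤ π(cw + ϑ) ≤ π(c+2)w`). [cite: AjankiHuveneers2011, §6.1 eqs. (6.6)-(6.7)] -/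
theorem resonant_e₂_bounds {w : ℝ} {B : ℕ → ℝ} (hw0 : 0 < w) (hw1 : w ≤ 1)
    (hB : ∀ k, π * w * (1 + |B k|) ≤ 1 / 2) {R c : ℝ} (k : ℕ)
    (h3 : ‖(ahPhase w 0 B (k + 1) : UnitAddCircle)‖ ≤ c * w) (h4 : ahGamma w 0 B (k + 1) ≤ c * R) :
    ahD (ahDiag w B) 0 1 (k + 1) ^ 2 ≤ 16 / 9 * c ^ 4 * R ^ 2 ∧
      ahD (ahDiag w B) 0 1 k ^ 2 ≤ 16 / 9 * c ^ 2 * R ^ 2 * (c + 2) ^ 2 := by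
  have hπ := Real.pi_pos
  obtain ⟨hw_half, -, -⟩ := ahSmall_consequences hw0 (hB 0)
  have hπw : 0 < π * w := mul_pos hπ hw0
  have hw5 : w ≤ 1 / 5 := by
    have h3w : 3 * w ≤ π * w := mul_le_mul_of_nonneg_right Real.pi_gt_three.le hw0.le
    linarith
  obtain ⟨hS, -⟩ := sin_pi_mul_ahTheta_bounds hw0.le hw_half
  have hθ0 : 0 ≤ ahTheta w := (ahTheta_pos hw0).le
  have hθ1 : ahTheta w ≤ w + w ^ 3 := ahTheta_le hw0.le hw5
  obtain ⟨-, hw32⟩ := pow_le_self_aux hw0 hw1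
  obtain ⟨ha2, h02⟩ := ahZeta_negE₂_zero w B
  have hρpos : 0 < ahAmp w B 0 (-1) 0 := by rw [ha2]; exact one_pos
  have hρ_nonneg : 0 ≤ ahAmp w B 0 (-1) (k + 1) := ahAmp_nonneg _ _ _ _ _
  have hρ_le : ahAmp w B 0 (-1) (k + 1) ≤ c * R := by
    rw [ahAmp_eq_mul_ahGamma hw0 hB h02 hρpos (Nat.succ_pos k), ahAmp_negE₂_one, one_mul]
    exact h4
  have hD := ahD_mul_sin_eq hw0 hB h02 (k + 1)
  have hP := ahDprev_mul_sin_eq hw0 hB h02 (k + 1)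
  rw [ahDprev_negE₂_succ] at hP
  rw [ahD_negE₂] at hD
  have hs3 : |Real.sin (π * ahPhase w 0 B (k + 1))| ≤ π * (c * w) :=
    (abs_sin_pi_mul_le_norm_coe _).trans (mul_le_mul_of_nonneg_left h3 hπ.le)
  have hs4 : |Real.sin (π * (ahPhase w 0 B (k + 1) - ahTheta w))| ≤ π * ((c + 2) * w) := by
    refine (abs_sin_pi_mul_le_norm_coe _).trans (mul_le_mul_of_nonneg_left ?_ hπ.le)
    refine (norm_coe_unitAddCircle_sub_le _ (ahTheta w)).trans ?_
    rw [abs_of_nonneg hθ0]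
    linarith
  have hπw0 : (π * w) ^ 2 ≠ 0 := by positivity
  constructor
  · have h := sq_le_of_mul_sin_eq hw0 hS hD hs3 hρ_nonneg hρ_le
    rw [neg_sq] at h
    have : 16 / 9 * (c * R * (π * (c * w))) ^ 2 / (π * w) ^ 2 = 16 / 9 * c ^ 4 * R ^ 2 := by
      rw [div_eq_iff hπw0]
      ring
    linarith
  · have h := sq_le_of_mul_sin_eq hw0 hS hP hs4 hρ_nonneg hρ_le
    rw [neg_sq] at h
    have : 16 / 9 * (c * R * (π * ((c + 2) * w))) ^ 2 / (π * w) ^ 2 =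
        16 / 9 * c ^ 2 * R ^ 2 * (c + 2) ^ 2 := by
      rw [div_eq_iff hπw0]
      ring
    linarith

/-- The constant `C₀(R, c, m̄)` of the resonant-set bound (`j_n ≥ 1/C₀` on the resonant set). [folklore] -/
def resonantConst (R c mb : ℝ) : ℝ :=
  2 + 64 / 9 * R ^ 2 * mb / π ^ 2 + 64 * R ^ 2 + 16 / 9 * c ^ 4 * R ^ 2 +
    π ^ 2 / mb * (16 / 9 * c ^ 2 * R ^ 2 * (c + 2) ^ 2)

/-- `C₀ > 0`. [folklore] -/
theorem resonantConst_pos (R c : ℝ) {mb : ℝ} (hmb : 0 < mb) : 0 < resonantConst R c mb := by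
  unfold resonantConst
  positivity

/-- The algebra of (6.6): with `ω² = π²w²/m̄`, `0 < w ≤ 1` and the four bounds of the resonant set,
`2ω² + D₁² + ω²(D₂² + D₃²) + ω⁴D₄² ≤ ω² C₀`, hence `j ≥ 1/C₀`. [cite: AjankiHuveneers2011, §6.1 eq. (6.6)] -/
theorem currentDensity_ge_of_bounds {w mb R c D₁ D₂ D₃ D₄ : ℝ} (hw0 : 0 < w) (hw1 : w ≤ 1) (hmb : 0 < mb)
    (e1 : D₁ ^ 2 ≤ 64 / 9 * R ^ 2 * w ^ 2) (e2 : D₂ ^ 2 ≤ 64 * R ^ 2)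
    (e3 : D₃ ^ 2 ≤ 16 / 9 * c ^ 4 * R ^ 2) (e4 : D₄ ^ 2 ≤ 16 / 9 * c ^ 2 * R ^ 2 * (c + 2) ^ 2) :
    1 / resonantConst R c mb ≤ (π * w / Real.sqrt mb) ^ 2 / (2 * (π * w / Real.sqrt mb) ^ 2 + D₁ ^ 2 +
      (π * w / Real.sqrt mb) ^ 2 * (D₂ ^ 2 + D₃ ^ 2) + (π * w / Real.sqrt mb) ^ 4 * D₄ ^ 2) := by
  have hπ := Real.pi_pos
  rw [show (π * w / Real.sqrt mb) ^ 4 = ((π * w / Real.sqrt mb) ^ 2) ^ 2 by ring]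
  set ω2 : ℝ := (π * w / Real.sqrt mb) ^ 2 with hω2
  have hω2_eq : ω2 = π ^ 2 * w ^ 2 / mb := by
    rw [hω2, div_pow, mul_pow, Real.sq_sqrt hmb.le]
  have hω2_pos : 0 < ω2 := by rw [hω2_eq]; positivity
  have hw2 : w ^ 2 = ω2 * mb / π ^ 2 := by
    rw [hω2_eq]; field_simp
  have hω2_le : ω2 ≤ π ^ 2 / mb := by
    rw [hω2_eq]
    refine div_le_div_of_nonneg_right ?_ hmb.le
    calc π ^ 2 * w ^ 2 ≤ π ^ 2 * 1 :=
          mul_le_mul_of_nonneg_left (pow_le_one₀ hw0.le hw1) (sq_nonneg π)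
      _ = π ^ 2 := mul_one _
  set Den : ℝ := 2 * ω2 + D₁ ^ 2 + ω2 * (D₂ ^ 2 + D₃ ^ 2) + ω2 ^ 2 * D₄ ^ 2 with hDen
  have hDen_pos : 0 < Den := by rw [hDen]; positivity
  have hK : 0 ≤ 16 / 9 * c ^ 2 * R ^ 2 * (c + 2) ^ 2 := by positivity
  have hC₀ := resonantConst_pos R c hmb
  have hDen_le : Den ≤ ω2 * resonantConst R c mb :=
    calc Den ≤ 2 * ω2 + 64 / 9 * R ^ 2 * w ^ 2 + ω2 * (64 * R ^ 2 + 16 / 9 * c ^ 4 * R ^ 2) +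
          ω2 ^ 2 * (16 / 9 * c ^ 2 * R ^ 2 * (c + 2) ^ 2) := by
          rw [hDen]
          gcongr
      _ = ω2 * (2 + 64 / 9 * R ^ 2 * mb / π ^ 2 + 64 * R ^ 2 + 16 / 9 * c ^ 4 * R ^ 2) +
            ω2 * (ω2 * (16 / 9 * c ^ 2 * R ^ 2 * (c + 2) ^ 2)) := by
          rw [hw2]
          field_simp
          ring
      _ ≤ ω2 * (2 + 64 / 9 * R ^ 2 * mb / π ^ 2 + 64 * R ^ 2 + 16 / 9 * c ^ 4 * R ^ 2) +
            ω2 * (π ^ 2 / mb * (16 / 9 * c ^ 2 * R ^ 2 * (c + 2) ^ 2)) := by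
          gcongr
      _ = ω2 * resonantConst R c mb := by unfold resonantConst; ring
  rw [div_le_div_iff₀ hC₀ hDen_pos, one_mul]
  exact hDen_le

/-- **(6.6)–(6.7), the deterministic core of the lower bound**: on the resonant set
`E = {|X^ϑ_n|_𝕋 ≤ w², Γ^ϑ_n ≤ R, |X^0_n|_𝕋 ≤ cw, Γ^0_n ≤ cR}` (`R ≥ 0`) the current density is of
order one — in the reduced variables of `clCurrentDensity_reduced` (`ω = πw/√m̄`, `n = k+1`):
`j_n = ω²/(2ω² + D_n(e₁)² + ω²(D_{n-1}(e₁)² + D_n(e₂)²) + ω⁴D_{n-1}(e₂)²) ≥ 1/C₀(R, c, m̄) > 0` whenever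
`0 < w ≤ 1` and `πw(1 + |B_k|) ≤ 1/2`, since by the polar form `|D_n(e₁)| ≲ Rw`, `|D_{n-1}(e₁)| ≲ R`,
`|D_n(e₂)| ≲ c²R`, `|D_{n-1}(e₂)| ≲ c(c+2)R` there (the paper: "`j_n(w) ≳ {1 + (Γ^ϑ_n sin X^ϑ_n)²/w⁴ +
(Γ^ϑ_{n-1} sin X^ϑ_{n-1})²/w² + (Γ^0_n sin X^0_n)²/w² + (Γ^0_{n-1} sin X^0_{n-1})²}⁻¹`", hence "`𝔼 j_n(w) ≳
P(|X^ϑ_n|_𝕋 ≤ w², Γ^ϑ_n ≤ R, |X^0_n|_𝕋 ≤ cw, Γ^0_n ≤ cR)`"; here `D_{n-1}` is read off `(ρ_n, X_n)`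
directly, so Cor. 3.4 (i) is not needed). [cite: AjankiHuveneers2011, §6.1 eqs. (6.6)-(6.7)] -/
theorem currentDensity_ge_on_resonantSet {w : ℝ} {B : ℕ → ℝ} (hw0 : 0 < w) (hw1 : w ≤ 1)
    (hB : ∀ k, π * w * (1 + |B k|) ≤ 1 / 2) {mb : ℝ} (hmb : 0 < mb) {R c : ℝ} (hR : 0 ≤ R)
    (k : ℕ) (h1 : ‖(ahPhase w (ahTheta w) B (k + 1) : UnitAddCircle)‖ ≤ w ^ 2) (h2 : ahGamma w (ahTheta w) B (k + 1) ≤ R)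
    (h3 : ‖(ahPhase w 0 B (k + 1) : UnitAddCircle)‖ ≤ c * w) (h4 : ahGamma w 0 B (k + 1) ≤ c * R) :
    1 / resonantConst R c mb ≤ (π * w / Real.sqrt mb) ^ 2 / (2 * (π * w / Real.sqrt mb) ^ 2 +
      ahD (ahDiag w B) 1 0 (k + 1) ^ 2 +
      (π * w / Real.sqrt mb) ^ 2 * (ahD (ahDiag w B) 1 0 k ^ 2 + ahD (ahDiag w B) 0 1 (k + 1) ^ 2) +
      (π * w / Real.sqrt mb) ^ 4 * ahD (ahDiag w B) 0 1 k ^ 2) := by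
  obtain ⟨e1, e2⟩ := resonant_e₁_bounds hw0 hw1 hB hR k h1 h2
  obtain ⟨e3, e4⟩ := resonant_e₂_bounds hw0 hw1 hB k h3 h4
  exact currentDensity_ge_of_bounds hw0 hw1 hmb e1 e2 e3 e4

/-- The smallness threshold `w₁(b₋, b₊) = min(1, 1/(2π(1 + max(|b₋|,|b₊|))))`: for `0 < w ≤ w₁` and
`B_k ∈ [b₋, b₊]`, `πw(1 + |B_k|) ≤ 1/2` and `w ≤ 1`. [folklore] -/
def smallFreq (bm bp : ℝ) : ℝ := min 1 (1 / (2 * π * (1 + max |bm| |bp|)))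

/-- `w₁ > 0`. [folklore] -/
theorem smallFreq_pos (bm bp : ℝ) : 0 < smallFreq bm bp := by
  unfold smallFreq
  have : 0 ≤ max |bm| |bp| := le_max_of_le_left (abs_nonneg _)
  positivity

/-- Below `w₁` the standing smallness assumption holds along any disorder sequence in `[b₋, b₊]`. [folklore] -/
theorem small_of_le_smallFreq {bm bp w : ℝ} (hw : w ≤ smallFreq bm bp) {B : ℕ → ℝ}
    (hBk : ∀ k, B k ∈ Set.Icc bm bp) : w ≤ 1 ∧ ∀ k, π * w * (1 + |B k|) ≤ 1 / 2 := by
  have hM0 : 0 ≤ max |bm| |bp| := le_max_of_le_left (abs_nonneg _)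
  refine ⟨hw.trans (min_le_left _ _), fun k => ?_⟩
  have hwM : w ≤ 1 / (2 * π * (1 + max |bm| |bp|)) := hw.trans (min_le_right _ _)
  have hbM : |B k| ≤ max |bm| |bp| := abs_le_max_abs_abs (hBk k).1 (hBk k).2
  have hπ := Real.pi_pos
  calc π * w * (1 + |B k|) ≤ π * (1 / (2 * π * (1 + max |bm| |bp|))) * (1 + max |bm| |bp|) := by
        gcongr
    _ = 1 / 2 := by field_simp

/-! ### From the physical band `κ/√(2n) ≤ ω ≤ κ/√n` to `1/2 ≤ w²n ≤ 1` -/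

/-- `1/√n ≤ m₀` once `n ≥ ⌈1/m₀²⌉`. [folklore] -/
theorem one_div_sqrt_le_of_ceil_le {m₀ : ℝ} (hm : 0 < m₀) {n : ℕ} (hn : ⌈1 / m₀ ^ 2⌉₊ ≤ n) (hn1 : 1 ≤ n) :
    1 / Real.sqrt n ≤ m₀ := by
  have h1 : 1 / m₀ ^ 2 ≤ n := (Nat.le_ceil _).trans (by exact_mod_cast hn)
  have hn' : (0 : ℝ) < n := by exact_mod_cast hn1
  have h2 : 1 ≤ m₀ ^ 2 * n := by
    rw [div_le_iff₀ (by positivity)] at h1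
    linarith
  rw [div_le_iff₀ (Real.sqrt_pos.mpr hn')]
  calc (1 : ℝ) = Real.sqrt 1 := Real.sqrt_one.symm
    _ ≤ Real.sqrt (m₀ ^ 2 * n) := Real.sqrt_le_sqrt h2
    _ = m₀ * Real.sqrt n := by rw [Real.sqrt_mul (sq_nonneg _), Real.sqrt_sq hm.le]

/-- **The change of frequency variable on the band**: for `ω ∈ [κ/√(2n), κ/√n]` with `κ = π/√m̄` and
`w := ω√m̄/π` one has `ω = πw/√m̄`, `0 < w ≤ 1/√n` and `1/2 ≤ w²n ≤ 1` (the paper's critical band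
`I = [(2n)^{-1/2}, n^{-1/2}]`). [cite: AjankiHuveneers2011, §2.2 ("for `w ∈ I := [(2n)^{-1/2}, n^{-1/2}]`") and §6.1] -/
theorem band_change_of_variable {mb ω : ℝ} (hmb : 0 < mb) {n : ℕ} (hn : 1 ≤ n)
    (hω : ω ∈ Set.Icc (π / Real.sqrt mb / Real.sqrt (2 * n)) (π / Real.sqrt mb / Real.sqrt n)) :
    0 < ω * Real.sqrt mb / π ∧ ω = π * (ω * Real.sqrt mb / π) / Real.sqrt mb ∧
      ω * Real.sqrt mb / π ≤ 1 / Real.sqrt n ∧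
      1 / 2 ≤ (ω * Real.sqrt mb / π) ^ 2 * n ∧ (ω * Real.sqrt mb / π) ^ 2 * n ≤ 1 := by
  have hπ := Real.pi_pos
  have hsm : 0 < Real.sqrt mb := Real.sqrt_pos.mpr hmb
  have hn' : (0 : ℝ) < n := by exact_mod_cast hn
  have hsn : 0 < Real.sqrt n := Real.sqrt_pos.mpr hn'
  have hs2n : 0 < Real.sqrt (2 * n) := Real.sqrt_pos.mpr (by positivity)
  obtain ⟨hlo, hhi⟩ := hω
  have hlo_pos : 0 < π / Real.sqrt mb / Real.sqrt (2 * n) := by positivity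
  have hω0 : 0 < ω := lt_of_lt_of_le hlo_pos hlo
  set w : ℝ := ω * Real.sqrt mb / π with hw
  have hw0 : 0 < w := by positivity
  have hωw : ω = π * w / Real.sqrt mb := by
    rw [hw]; field_simp
  refine ⟨hw0, hωw, ?_, ?_, ?_⟩
  · -- `w ≤ 1/√n`
    calc w = ω * Real.sqrt mb / π := hw
      _ ≤ (π / Real.sqrt mb / Real.sqrt n) * Real.sqrt mb / π := by gcongr
      _ = 1 / Real.sqrt n := by field_simp
  · -- `1/2 ≤ w² n` from `ω ≥ π/(√m̄ √(2n))`
    have h1 : (π / Real.sqrt mb / Real.sqrt (2 * n)) ^ 2 ≤ ω ^ 2 :=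
      pow_le_pow_left₀ hlo_pos.le hlo 2
    have h2 : (π / Real.sqrt mb / Real.sqrt (2 * n)) ^ 2 = π ^ 2 / (mb * (2 * n)) := by
      rw [div_pow, div_pow, Real.sq_sqrt hmb.le, Real.sq_sqrt (by positivity)]
      field_simp
    rw [h2] at h1
    have h3 : w ^ 2 * n = ω ^ 2 * (mb * n) / π ^ 2 := by
      rw [hw, div_pow, mul_pow, Real.sq_sqrt hmb.le]
      field_simp
    rw [h3, le_div_iff₀ (by positivity)]
    rw [div_le_iff₀ (by positivity)] at h1
    nlinarith
  · -- `w² n ≤ 1` from `ω ≤ π/(√m̄ √n)`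
    have h1 : ω ^ 2 ≤ (π / Real.sqrt mb / Real.sqrt n) ^ 2 := pow_le_pow_left₀ hω0.le hhi 2
    have h2 : (π / Real.sqrt mb / Real.sqrt n) ^ 2 = π ^ 2 / (mb * n) := by
      rw [div_pow, div_pow, Real.sq_sqrt hmb.le, Real.sq_sqrt hn'.le]
      field_simp
    rw [h2] at h1
    have h3 : w ^ 2 * n = ω ^ 2 * (mb * n) / π ^ 2 := by
      rw [hw, div_pow, mul_pow, Real.sq_sqrt hmb.le]
      field_simp
    rw [h3, div_le_iff₀ (by positivity)]
    rw [le_div_iff₀ (by positivity)] at h1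
    linarith

/-- Measurability of the reduced current density `β ↦ j_n(ω; m̄(1+β))`. [folklore] -/
theorem measurable_clCurrentDensity_reduced (mb ω : ℝ) (n : ℕ) :
    Measurable fun β : Fin n → ℝ => clCurrentDensity (fun k => mb * (1 + β k)) ω := by
  have hg : Measurable fun β : Fin n → ℝ => ((fun k => mb * (1 + β k)), ω) := by
    refine Measurable.prodMk (measurable_pi_lambda _ fun k => ?_) measurable_const
    exact measurable_const.mul (measurable_const.add (measurable_pi_apply k))
  exact (measurable_clCurrentDensity n).comp hg

/-- Integrability of the reduced current density (bounded by `1/2`). [folklore] -/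
theorem integrable_clCurrentDensity_reduced (mb ω : ℝ) (n : ℕ) (μ : Measure (Fin n → ℝ))
    [IsFiniteMeasure μ] :
    Integrable (fun β : Fin n → ℝ => clCurrentDensity (fun k => mb * (1 + β k)) ω) μ := by
  refine Integrable.mono' (integrable_const (1 / 2 : ℝ))
    (measurable_clCurrentDensity_reduced mb ω n).aestronglyMeasurable (ae_of_all _ fun β => ?_)
  rw [Real.norm_eq_abs, abs_of_nonneg (clCurrentDensity_nonneg _ ω)]
  exact clCurrentDensity_le_half _ ω

end Literature.Barriers.AtomisticToContinuum.HeatConduction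

namespace Literature.Barriers.AtomisticToContinuum

open Literature.MathematicalPhysics.KineticTheory.HeatConduction HeatConduction

/-! ### The named facts of the lower bound (§3.2, §6.1) -/

/-- The martingale `M_n = w ∑_{j=1}^n φ'(X^ϑ_{j-1}) B_j` of Lemma 3.7, `φ(x) = sin² πx`, `φ'(x) = π sin 2πx`
(here `B j` is the paper's `B_{j+1}`, so the sum runs over `j < n`).
[cite: AjankiHuveneers2011, Lemma 3.7 eq. (3.27) with (3.16)] -/
def ahMart (w : ℝ) (B : ℕ → ℝ) (n : ℕ) : ℝ :=
  w * ∑ j ∈ Finset.range n, π * Real.sin (2 * π * ahPhase w (ahTheta w) B j) * B j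

/-- **Lemma 3.7 with Lemma 6.1 (joint behaviour of `(X^ϑ_n, X^0_n, Γ^ϑ_n, Γ^0_n)`, tail form).** Lemma 3.7
("Representations for the lower bound"): "for all `n ∈ ℕ` and `w ∈ ]0,w₀]`:
`X^ϑ_n - X^0_n = w e^{M_n + L_n + 𝒪(w²n)}`, `Γ^0_n/Γ^ϑ_n = e^{K_n + 𝒪(w + w²n)}`, where `(M_n), (L_n), (K_n)`
are `ℝ`-valued `𝔽`-martingales such that `M_0 = L_0 = K_0 = 0` and `ΔM_n = wφ'(X^ϑ_{n-1})B_n`,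
`ΔL_n = w²e^{M_{n-1}+L_{n-1}+𝒪(w²n)}H_{n-1}B_n`, `ΔK_n = w²e^{M_{n-1}+L_{n-1}+𝒪(w²n)}U_{n-1}B_n`", `(H_n)`,
`(U_n)` adapted and bounded; Lemma 6.1: "For every `α > 0`, there exists `C(α) > 0`, such that, for every
`a > 0`, and every `n ∈ ℕ` satisfying `w²n ≤ 1`, one has `P(|K_n| ≥ a), P(|L_n| ≥ a) ≤ C(α)w^α`" (eq. (6.2);
Azuma's inequality; used with `a = 1`). Vendored in the form in which §6.1 consumes the two lemmas —
(6.8): "`χ_{B(cw)}(X^0_n) ≥ χ_{[0,R]}(e^{M_n}) χ_{B(0,1)}(L_n) χ_{B(0,w²)}(X^ϑ_n)` provided `c` is large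
enough" and (6.9): "`χ_{[0,cR]}(Γ^0_n) ≥ χ_{B(0,1)}(K_n) χ_{[0,R]}(Γ^ϑ_n)`", each failing only on
`{|L_n| > 1}` resp. `{|K_n| > 1}`: for the reduced law `τ` and every `α > 0` there are `C, c₀, w₀ > 0`
such that for `0 < w ≤ w₀`, `n ≥ 1` with `w²n ≤ 1`, and every `R`,
`P(e^{M_n} ≤ R and X^ϑ_n - X^0_n > c₀Rw) ≤ Cw^α` and `P(Γ^0_n > c₀Γ^ϑ_n) ≤ Cw^α`
(`(B_1,…,B_n) ∼ τ^{⊗n}`, lifted chains `X^ϑ = ahPhase w ϑ`, `X^0 = ahPhase w 0`, `M_n = ahMart`).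
[cite: AjankiHuveneers2011, Lemma 3.7 eqs. (3.25)-(3.30), Lemma 6.1 eq. (6.2), §6.1 eqs. (6.8)-(6.9)] -/
def AjankiHuveneers2011_jointBehaviourTails : Prop :=
  ∀ (τ : ℝ → ℝ) (bm bp : ℝ), ReducedLawHyp τ bm bp →
    ∀ (ρB : Measure ℝ) [IsProbabilityMeasure ρB],
      ρB = volume.withDensity (fun s => ENNReal.ofReal (τ s)) →
      ∀ α : ℝ, 0 < α → ∃ C c₀ w₀ : ℝ, 0 < C ∧ 0 < c₀ ∧ 0 < w₀ ∧ ∀ w ∈ Set.Ioc 0 w₀, ∀ n : ℕ, 1 ≤ n →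
        w ^ 2 * n ≤ 1 →
          (∀ R : ℝ, (Measure.pi fun _ : Fin n => ρB).real
              {B | Real.exp (ahMart w (finExt B) n) ≤ R ∧
                c₀ * R * w < ahPhase w (ahTheta w) (finExt B) n - ahPhase w 0 (finExt B) n} ≤
            C * w ^ α) ∧
          (Measure.pi fun _ : Fin n => ρB).real
              {B | c₀ * ahGamma w (ahTheta w) (finExt B) n < ahGamma w 0 (finExt B) n} ≤ C * w ^ α

/-- **§6.1, the resonant set has probability `≳ w²`.** With
`E_n = {|X^ϑ_n|_𝕋 ≤ w², Γ^ϑ_n ≤ R, |X^0_n|_𝕋 ≤ cw, Γ^0_n ≤ cR}` the paper shows (last display of §6.1)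
`P(E_n) ≥ P(|X^ϑ_n|_𝕋 ≤ w²) - P(|L_n| > 1) - P(|K_n| > 1) - R⁻¹𝔼[χ_{B(0,w²)}(X^ϑ_n)Γ^ϑ_n] -
R⁻¹𝔼[χ_{B(0,w²)}(X^ϑ_n)e^{M_n}]` and concludes "Proposition 5.1 and Lemma 6.1 allow then to conclude that
`𝔼(j_n(w)) ≳ w²` if `R` is chosen large enough", the right-hand side being `≳ w²` by Prop. 5.1 (lower bound
with `h = 0`, `u = χ_{B(0,w²)}`; upper bound with `h = s` and `h = φ'`) and Lemma 6.1. Vendored as that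
intermediate conclusion: for the reduced law `τ` there are `R, c`, `K > 0`, `w₀ > 0` such that for
`0 < w ≤ w₀` and `1/2 ≤ w²n ≤ 1`, `P(E_n) ≥ Kw²` (`(B_1,…,B_n) ∼ τ^{⊗n}`; lifted chains `ahPhase`, amplitudes
`ahGamma` of `…Phases.lean`, `|x|_𝕋 = ‖(x : UnitAddCircle)‖`). Inputs in the tree: `AjankiHuveneers2011_potentialTheory`
(Prop. 5.1), `AjankiHuveneers2011_logGammaExpansion` ((3.21), `Γ_n ≲ e^{w∑s(X)B}` for `w²n ≤ 1`),
`AjankiHuveneers2011_jointBehaviourTails` (Lemmas 3.7 + 6.1).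
[cite: AjankiHuveneers2011, §6.1 eq. (6.7) and the two unnumbered displays following (6.9), with Prop. 5.1 and Lemma 6.1] -/
def AjankiHuveneers2011_resonantSetProbability : Prop :=
  ∀ (τ : ℝ → ℝ) (bm bp : ℝ), ReducedLawHyp τ bm bp →
    ∀ (ρB : Measure ℝ) [IsProbabilityMeasure ρB],
      ρB = volume.withDensity (fun s => ENNReal.ofReal (τ s)) →
      ∃ R c K w₀ : ℝ, 0 < K ∧ 0 < w₀ ∧ ∀ w ∈ Set.Ioc 0 w₀, ∀ n : ℕ,
        1 / 2 ≤ w ^ 2 * n → w ^ 2 * n ≤ 1 →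
          K * w ^ 2 ≤ (Measure.pi fun _ : Fin n => ρB).real
            {B | ‖(ahPhase w (ahTheta w) (finExt B) n : UnitAddCircle)‖ ≤ w ^ 2 ∧
              ahGamma w (ahTheta w) (finExt B) n ≤ R ∧
              ‖(ahPhase w 0 (finExt B) n : UnitAddCircle)‖ ≤ c * w ∧
              ahGamma w 0 (finExt B) n ≤ c * R}

/-! ### The reduction: resonant set `⟹` (L) -/

/-- **(L) from the resonant-set probability**: `AjankiHuveneers2011_resonantSetProbability` implies
`AjankiHuveneers2011_criticalBandLowerBound`, with `κ = π/√𝔼M` (so that the band `κ/√(2n) ≤ ω ≤ κ/√n` is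
exactly `1/2 ≤ w²n ≤ 1` for `w = ω√𝔼M/π`), `n₀` large enough that `w ≤ 1/√n₀` is below the thresholds, and
`c = K m̄/(π² C₀(|R|+1, |c|+1, m̄))`: the mass average is the reduced average (`…Reduced.lean`), which by
Markov's inequality is `≥ c₀ P(j_n ≥ c₀) ≥ c₀ P(E_n)` (`E_n ⊆ {j_n ≥ c₀}` up to the null set of
out-of-support reduced masses, by `currentDensity_ge_on_resonantSet`), `≥ c₀ K w²`. This is §6.1 of the
paper from (6.7) on: "`𝔼 j_n(w) ≳ P(E_n)`" and "`𝔼(j_n(w)) ≳ w²`".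
[cite: AjankiHuveneers2011, §6.1 eqs. (6.6)-(6.7)] -/
theorem AjankiHuveneers2011_criticalBandLowerBound_of_resonantSet
    (hRes : AjankiHuveneers2011_resonantSetProbability) : AjankiHuveneers2011_criticalBandLowerBound := by
  intro τ a b hτ ρ _ hρ
  have hm := hτ.meanMass_pos
  have hred := hτ.reducedLawHyp
  haveI := isProbabilityMeasure_map_reducedEquiv hτ ρ
  have hρB : Measure.map (reducedEquiv (meanMass τ) hτ.meanMass_pos.ne') ρ =
      volume.withDensity (fun β => ENNReal.ofReal (reducedDensity τ β)) := by
    rw [hρ]; exact map_reducedEquiv_withDensity hτ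
  obtain ⟨R, c, K, w₀, hK, hw₀, hcore⟩ := hRes _ _ _ hred _ hρB
  -- constants
  set mb : ℝ := meanMass τ with hmb
  set bm : ℝ := a / mb - 1 with hbm
  set bp : ℝ := b / mb - 1 with hbp
  set R' : ℝ := |R| + 1 with hR'
  set c' : ℝ := |c| + 1 with hc'
  have hR'0 : 0 ≤ R' := by positivity
  have hc'0 : 0 ≤ c' := by positivity
  set c₀ : ℝ := 1 / resonantConst R' c' mb with hc₀
  have hc₀_pos : 0 < c₀ := by rw [hc₀]; exact one_div_pos.mpr (resonantConst_pos R' c' hm)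
  set m₀ : ℝ := min w₀ (smallFreq bm bp) with hm₀
  have hm₀_pos : 0 < m₀ := lt_min hw₀ (smallFreq_pos bm bp)
  refine ⟨π / Real.sqrt mb, by positivity, c₀ * K * mb / π ^ 2, by positivity,
    max (⌈1 / m₀ ^ 2⌉₊) 1, fun n hn ω hω => ?_⟩
  have hn1 : 1 ≤ n := le_trans (le_max_right _ _) hn
  have hnc : ⌈1 / m₀ ^ 2⌉₊ ≤ n := le_trans (le_max_left _ _) hn
  obtain ⟨hw0, hωw, hwn, hband1, hband2⟩ := band_change_of_variable hm hn1 hω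
  set w : ℝ := ω * Real.sqrt mb / π with hw
  have hwm₀ : w ≤ m₀ := hwn.trans (one_div_sqrt_le_of_ceil_le hm₀_pos hnc hn1)
  have hw₀' : w ≤ w₀ := hwm₀.trans (min_le_left _ _)
  have hw₁ : w ≤ smallFreq bm bp := hwm₀.trans (min_le_right _ _)
  have hw_one : w ≤ 1 := hw₁.trans (min_le_left _ _)
  obtain ⟨k, rfl⟩ : ∃ k, n = k + 1 := ⟨n - 1, by omega⟩
  -- the reduced average and Markov's inequality
  set μ : Measure (Fin (k + 1) → ℝ) := Measure.pi fun _ : Fin (k + 1) =>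
    Measure.map (reducedEquiv (meanMass τ) hτ.meanMass_pos.ne') ρ with hμ
  set F : (Fin (k + 1) → ℝ) → ℝ := fun β => clCurrentDensity (fun i => mb * (1 + β i)) ω with hF
  have havg : clAvgCurrentDensity ρ (k + 1) ω = ∫ β, F β ∂μ :=
    integral_pi_eq_integral_pi_reduced hτ ρ (k + 1) (fun m => clCurrentDensity m ω)
  have hF_int : Integrable F μ := integrable_clCurrentDensity_reduced mb ω (k + 1) μ
  have hMarkov := mul_meas_ge_le_integral_of_nonneg (μ := μ)
    (ae_of_all _ fun β => clCurrentDensity_nonneg _ ω) hF_int c₀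
  -- the resonant set is contained in `{j ≥ c₀}` up to a null set
  have hP := hcore w ⟨hw0, hw₀'⟩ (k + 1) hband1 hband2
  set E : Set (Fin (k + 1) → ℝ) := {B : Fin (k + 1) → ℝ |
      ‖(ahPhase w (ahTheta w) (finExt B) (k + 1) : UnitAddCircle)‖ ≤ w ^ 2 ∧
        ahGamma w (ahTheta w) (finExt B) (k + 1) ≤ R ∧
        ‖(ahPhase w 0 (finExt B) (k + 1) : UnitAddCircle)‖ ≤ c * w ∧
        ahGamma w 0 (finExt B) (k + 1) ≤ c * R} with hEdef
  set T : Set (Fin (k + 1) → ℝ) := {B | c₀ ≤ F B} with hTdef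
  have hae : ∀ᵐ β ∂μ, ∀ i, bm ≤ β i ∧ β i ≤ bp := ae_pi_mem_Icc hred.eq_zero hρB (k + 1)
  have hbm0 : bm ≤ 0 := by
    rw [hbm, sub_nonpos, div_le_one hm]; exact hτ.le_meanMass
  have hbp0 : 0 ≤ bp := by
    rw [hbp, sub_nonneg, one_le_div hm]; exact hτ.meanMass_le
  have hincl : E ≤ᵐ[μ] T := by
    refine hae.mono fun β hβ => ?_
    show β ∈ E → β ∈ T
    intro hβE
    rw [hEdef] at hβE
    obtain ⟨h1, h2, h3, h4⟩ := hβE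
    have hBk : ∀ j, finExt β j ∈ Set.Icc bm bp := by
      intro j
      by_cases hj : j < k + 1
      · rw [finExt_of_lt _ hj]; exact hβ ⟨j, hj⟩
      · simp only [finExt, dif_neg hj]; exact ⟨hbm0, hbp0⟩
    obtain ⟨-, hB⟩ := small_of_le_smallFreq hw₁ hBk
    have h2' : ahGamma w (ahTheta w) (finExt β) (k + 1) ≤ R' :=
      h2.trans ((le_abs_self R).trans (by linarith))
    have h3' : ‖(ahPhase w 0 (finExt β) (k + 1) : UnitAddCircle)‖ ≤ c' * w :=
      h3.trans (mul_le_mul_of_nonneg_right ((le_abs_self c).trans (by linarith)) hw0.le)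
    have h4' : ahGamma w 0 (finExt β) (k + 1) ≤ c' * R' := by
      refine h4.trans ((le_abs_self _).trans ?_)
      rw [abs_mul]
      exact mul_le_mul (by linarith) (by linarith) (abs_nonneg _) hc'0
    have hmain := currentDensity_ge_on_resonantSet hw0 hw_one hB hm hR'0 k h1 h2' h3' h4'
    show c₀ ≤ clCurrentDensity (fun i => mb * (1 + β i)) ω
    rw [hωw, clCurrentDensity_reduced mb hm β w]
    exact hmain
  have hmono : μ.real E ≤ μ.real T := by
    simp only [measureReal_def]
    exact ENNReal.toReal_mono (measure_ne_top _ _) (measure_mono_ae hincl)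
  -- assemble
  have hω2 : ω ^ 2 = π ^ 2 * w ^ 2 / mb := by
    rw [hωw, div_pow, mul_pow, Real.sq_sqrt hm.le]
  calc c₀ * K * mb / π ^ 2 * ω ^ 2 = c₀ * (K * w ^ 2) := by
        rw [hω2]; field_simp
    _ ≤ c₀ * μ.real T := mul_le_mul_of_nonneg_left (hP.trans hmono) hc₀_pos.le
    _ ≤ ∫ β, F β ∂μ := hMarkov
    _ = clAvgCurrentDensity ρ (k + 1) ω := havg.symm

end Literature.Barriers.AtomisticToContinuum

end
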